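import Literature.AnabelianGeometry.SemiGraphs.TemperedAnabelianMorphisms
import Mathlib.GroupTheory.Abelianization.Defs
import Mathlib.LinearAlgebra.TensorProduct.Basic

/-!
# Torsion closed points and Tate modules ([SemiAnbd] §6, Thm. 6.8 (iii), second sentence)

Mochizuki, *Semi-graphs of anabelioids*, Publ. RIMS **42** (2006) [SemiAnbd], §6, Theorem 6.8
(iii), author's manuscript p. 75: "In the situation of (ii) above, suppose further that `X_K`, `Y_L`
are once-punctured elliptic curves. Then `α` preserves the decomposition groups of the 'torsion
closed points' — i.e., the closed points that arise from torsion points of the underlying elliptic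
curve. Moreover, the resulting bijection between torsion closed points of `X_K`, `Y_L` is
compatible with the isomorphism on abelianizations of geometric fundamental groups
`Δ_X^ab ⥲ Δ_Y^ab` — i.e., 'Tate modules' — induced by `α`."
[cite: MochizukiSemiAnbd2006, Thm 6.8(iii) p.75]

The first sentence is `TemperedCurve.IsoPreservesTorsionDecomp` (`TemperedAnabelianMorphisms.lean`,
seat abc-iut-L3-t4 gen 0), whose docstring left the second sentence as TODO(general form).  This
file types the second sentence (cell abc-iut, layer L3, seat abc-iut-L3-t4 gen 3; additive).  It is
the clause [EtTh] leans on in the proof of its Theorem 1.10 (ii) (constant multiple rigidity; [EtTh]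
ms p. 28: "By applying [SemiAnbd], Theorem 6.8, (iii), … `γ` maps [the decomposition group of points
of `Ÿ_α` lying over] `τ` to [that over] `τ^{±1}`") and in [EtTh] Remark 1.6.1 (non-cuspidal torsion
points are temp-absolute) — consumers: `Literature/AnabelianGeometry/EtaleTheta/` (seat L2-t1,
`ConstantMultipleRigidity.lean`).

## Rendering

For a once-punctured elliptic curve `X = E ∖ {O}` over `K`, the profinite geometric fundamental group
`Δ_X` (`X.DeltaHat`, [SemiAnbd] p. 69) has abelianization `Δ_X^ab = T(E)`, the Tate module, and the
torsion points of `E(K̄)` are `T(E) ⊗ ℚ/ℤ = ⋃ₙ T(E)/n`; a closed point of `X̄_K` is a `G_K`-orbit of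
`K̄`-points.  Accordingly this file DEFINES over Mathlib `Δ_X^ab` (`TemperedCurve.DeltaHatAb`, the
abelianization of `X.DeltaHat`, written additively), the torsion module `Δ_X^ab ⊗_ℤ ℚ/ℤ`
(`TemperedCurve.TorsionModule`) and the map `Δ_X^ab ⊗ ℚ/ℤ → Δ_Y^ab ⊗ ℚ/ℤ` induced by an isomorphism
`β : Δ_X ⥲ Δ_Y` (`TemperedCurve.torsionMap`); records as INTERFACE data the parametrisation of the
torsion closed points of `X̄_K` by `Δ_X^ab ⊗ ℚ/ℤ` (`TorsionPointData`: the elliptic curve, its torsion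
points and the closed points under them are not in the tree -- TODO-merge: abc-iut-L4-t1); and types
the printed compatibility as the PREDICATE `TemperedCurve.IsoTorsionBijectionTateCompatible`: for
the profinite completion `α̂` of `α` and the isomorphism `β : Δ_X ⥲ Δ_Y` it restricts to ("induced
by `α`"; both universally quantified through their defining compatibilities, which determine them
for genuine data), the decomposition group of the torsion closed point with parameter `t` is carried
by `α` to (a conjugate of) that of the torsion closed point of `Y_L` with parameter `β_*(t)`.  The
printed statement is bundled over the ORIGIN hypotheses as `…Holds Ω` (`TemperedTorsionOrigin p`
extends `TemperedMorphismOrigin p` by a certificate for the torsion data; never constructed; cell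
gate lesson G1); nothing is asserted.  "Δ^ab" is rendered as the abstract abelianization of the
profinite group `Δ_X` (for the genuine, topologically finitely generated `Δ_X` its commutator
subgroup is closed).  No statement is strengthened; nothing here takes a side on [IUTchIII] Cor. 3.12.
-/

noncomputable section

namespace Literature.AnabelianGeometry.SemiGraphs

open scoped Pointwise TensorProduct

variable {p : ℕ} [Fact p.Prime]

namespace TemperedCurve

/-! ### Tate modules and torsion modules from the interface -/

/-- `Δ_X^ab`, the abelianization of the profinite geometric fundamental group `Δ_X` (p. 75: "the
abelianizations of geometric fundamental groups `Δ_X^ab` … i.e., 'Tate modules'"), as an additive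
abelian group. [cite: MochizukiSemiAnbd2006, Thm 6.8(iii) p.75] -/
abbrev DeltaHatAb (X : TemperedCurve p) : Type := Additive (Abelianization X.DeltaHat)

/-- `ℚ/ℤ`. [cite: MochizukiSemiAnbd2006, Thm 6.8(iii) p.75] -/
abbrev QModZ : Type := ℚ ⧸ AddSubgroup.zmultiples (1 : ℚ)

/-- The torsion module `Δ_X^ab ⊗_ℤ ℚ/ℤ` — for a once-punctured elliptic curve `X = E ∖ {O}`, the group
of torsion points of `E(K̄)` ("the closed points that arise from torsion points of the underlying
elliptic curve", p. 75, are its `G_K`-orbits). [cite: MochizukiSemiAnbd2006, Thm 6.8(iii) p.75] -/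
abbrev TorsionModule (X : TemperedCurve p) : Type := DeltaHatAb X ⊗[ℤ] QModZ

/-- The homomorphism `Δ_X^ab → Δ_Y^ab` ("isomorphism on abelianizations … induced by", p. 75) induced
by an isomorphism `β : Δ_X ⥲ Δ_Y`. [cite: MochizukiSemiAnbd2006, Thm 6.8(iii) p.75] -/
def deltaHatAbMap {X Y : TemperedCurve p} (β : X.DeltaHat ≃ₜ* Y.DeltaHat) :
    DeltaHatAb X →+ DeltaHatAb Y :=
  MonoidHom.toAdditive (Abelianization.map β.toMulEquiv.toMonoidHom)

/-- The map `Δ_X^ab ⊗ ℚ/ℤ → Δ_Y^ab ⊗ ℚ/ℤ` on torsion modules induced by an isomorphism `β : Δ_X ⥲ Δ_Y`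
(the Tate-module side of the "resulting bijection between torsion closed points", p. 75).
[cite: MochizukiSemiAnbd2006, Thm 6.8(iii) p.75] -/
def torsionMap {X Y : TemperedCurve p} (β : X.DeltaHat ≃ₜ* Y.DeltaHat) :
    TorsionModule X →ₗ[ℤ] TorsionModule Y :=
  TensorProduct.map (deltaHatAbMap β).toIntLinearMap LinearMap.id

/-! ### Torsion closed points as interface data -/

/-- The torsion closed points of `X̄_K` for a once-punctured elliptic curve `X_K = E ∖ {O}`, as
INTERFACE data over the arithmetic flags `a` of `TemperedAnabelianMorphisms.lean` (p. 75: "the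
'torsion closed points' — i.e., the closed points that arise from torsion points of the underlying
elliptic curve"): the closed point of `X̄_K` lying under the torsion point of `E(K̄)` with parameter
`t ∈ Δ_X^ab ⊗ ℚ/ℤ = T(E) ⊗ ℚ/ℤ = E(K̄)_tors`.  INTERFACE BOUNDARY: the elliptic curve and its points
are not in the tree -- TODO-merge: abc-iut-L4-t1. [cite: MochizukiSemiAnbd2006, Thm 6.8(iii) p.75] -/
structure TorsionPointData (X : TemperedCurve p) (a : CurveArithmeticFlags X) : Type where
  /-- the closed point of `X̄_K` under the torsion point with parameter `t` -/
  torsionPt : TorsionModule X → X.Pt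
  /-- these are exactly the torsion closed points -/
  range_torsionPt : Set.range torsionPt = {x | a.IsTorsionPt x}

/-! ### Theorem 6.8 (iii), second sentence -/

/-- **[SemiAnbd] Theorem 6.8 (iii), second sentence**, p. 75: "Moreover, the resulting bijection
between torsion closed points of `X_K`, `Y_L` is compatible with the isomorphism on abelianizations
of geometric fundamental groups `Δ_X^ab ⥲ Δ_Y^ab` — i.e., 'Tate modules' — induced by `α`."  Typed
as: for once-punctured elliptic curves, for the profinite completion `α̂ : Π_{X_K} ⥲ Π_{Y_L}` of
`α` (`α̂ ∘ ι_X = ι_Y ∘ α`) and the isomorphism `β : Δ_X ⥲ Δ_Y` it restricts to, and every torsion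
parameter `t`, `α` carries the decomposition group of the torsion closed point of `X̄_K` with
parameter `t` to a conjugate of the decomposition group of the torsion closed point of `Ȳ_L` with
parameter `β_*(t)` — so that the bijection of the first sentence (`IsoPreservesTorsionDecomp`) is the
one induced on `G_K`-orbits by `β^ab ⊗ ℚ/ℤ`. [cite: MochizukiSemiAnbd2006, Thm 6.8(iii) p.75] -/
def IsoTorsionBijectionTateCompatible (X Y : TemperedCurve p) (aX : CurveArithmeticFlags X)
    (aY : CurveArithmeticFlags Y) (TX : TorsionPointData X aX) (TY : TorsionPointData Y aY)
    (α : X.PiTemp ≃ₜ* Y.PiTemp) : Prop :=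
  aX.IsOncePuncturedElliptic → aY.IsOncePuncturedElliptic →
    ∀ αhat : X.PiHat ≃ₜ* Y.PiHat, (∀ g : X.PiTemp, αhat (X.toHat g) = Y.toHat (α g)) →
    ∀ β : X.DeltaHat ≃ₜ* Y.DeltaHat, (∀ d : X.DeltaHat, (β d : Y.PiHat) = αhat d) →
    ∀ t : TorsionModule X, ∃ γ : ConjAct Y.PiTemp,
      (X.decomp (TX.torsionPt t)).map α.toMulEquiv.toMonoidHom =
        γ • Y.decomp (TY.torsionPt (torsionMap β t))

end TemperedCurve

/-! ### The printed statement over the origin hypotheses -/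

/-- ORIGIN hypotheses for the data of this file (extending `TemperedMorphismOrigin p`; threaded as a
parameter, never constructed): "`T` IS the parametrisation of the torsion closed points of `X̄_K` by
`T(E) ⊗ ℚ/ℤ`" for a once-punctured elliptic curve `X_K = E ∖ {O}` (p. 75).
-- TODO-merge: abc-iut-L4-t1. [cite: MochizukiSemiAnbd2006, Thm 6.8(iii) p.75] -/
structure TemperedTorsionOrigin (p : ℕ) [Fact p.Prime] extends TemperedMorphismOrigin p where
  /-- "`T` is the genuine torsion-point parametrisation of `X̄_K`" -/
  IsTorsionPtOrigin : ∀ {X : TemperedCurve p} {a : TemperedCurve.CurveArithmeticFlags X},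
    TemperedCurve.TorsionPointData X a → Prop

namespace TemperedTorsionOrigin

/-- **[SemiAnbd] Theorem 6.8 (iii)** (p. 75), both sentences, as printed: for all hyperbolic curves
`X_K`, `Y_L` over finite extensions of `ℚ_p` with their genuine arithmetic adjectives and torsion
data and every isomorphism of tempered groups `α : Π^temp_{X_K} ⥲ Π^temp_{Y_L}` — if both are
once-punctured elliptic curves, `α` preserves the decomposition groups of the torsion closed points,
compatibly with the isomorphism of Tate modules induced by `α` (asserted only for certified data).
[cite: MochizukiSemiAnbd2006, Thm 6.8(iii) p.75] -/
def TorsionPointsHolds (Ω : TemperedTorsionOrigin p) : Prop :=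
  ∀ (X Y : TemperedCurve p) (aX : TemperedCurve.CurveArithmeticFlags X)
    (aY : TemperedCurve.CurveArithmeticFlags Y) (TX : TemperedCurve.TorsionPointData X aX)
    (TY : TemperedCurve.TorsionPointData Y aY),
    Ω.IsHyperbolicCurveOrigin X → Ω.IsHyperbolicCurveOrigin Y → Ω.IsFlagsOrigin aX →
    Ω.IsFlagsOrigin aY → Ω.IsTorsionPtOrigin TX → Ω.IsTorsionPtOrigin TY →
    ∀ α : X.PiTemp ≃ₜ* Y.PiTemp,
      X.IsoPreservesTorsionDecomp Y aX aY α ∧ X.IsoTorsionBijectionTateCompatible Y aX aY TX TY α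

end TemperedTorsionOrigin

end Literature.AnabelianGeometry.SemiGraphs

end
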